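import Summits.QuantumFields.YangMills.Theorems.BalabanUVNodesN08AtRecord9CB10
import Summits.QuantumFields.YangMills.Theorems.BalabanUVNodesN06AtRecord9CB10Y
import Literature.MathematicalPhysics.QuantumFieldTheory.Balaban1983to89.Node00.Record10Carriers
import Literature.MathematicalPhysics.QuantumFieldTheory.Balaban1983to89.Node00.CarriersW

/-!
# BalabanUVNodes ∕ N08 at the CUMULATIVE CARRIER PIN OF RECORD AT STAGE 10, `Node00.IsRecordOfRecord₁₀CB10YZ` — the ₁₀ twin of N08's census
# line (`BalabanUVNodesN08AtRecord9CB10`): the stub `YMDAG.UVSplit.S_N08 Rec := AtRecord Rec Dag.B10_main` READ and CLOSED BY NAME over node00-def g30's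
# `Node00/Record10Carriers.lean` (def-T's β-re-pointed machine stage `Record10` with the [B10] ∕ [B9] ∕ [B11] groups pinned), the new face at ₁₀ (the
# in-edges `b9 b11` are now PINNED BUNDLE LEAVES, not residual world leaves), the supplier face unchanged, and the inhabitation ∕ vacuity guards
# (Track A, DAG node N08 [Balaban1985UV3] CMP 102 (1985) 255, Thm 1 p. 257 (compact reading) + Thm 2 p. 272; cluster K3; KNIT-BY-NAME seat
# `pub-ymgap-dag-n08-a` g6, trigger (t6) of `HANDOFF-dag-n08-a.md` = `Record10Carriers` p430553, 2026-08-26)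

HONEST FRAMING.  Count-neutral kernel bookkeeping BY NAME over LANDED modules: `Node00.Record10Carriers` (`IsRecordOfRecord₁₀CB10YZ`,
`b10_main_of∕_iff_of_isRecordOfRecord₁₀CB10YZ`, `leaves_b9_b10_b11_iff_of_isRecordOfRecord₁₀CB10YZ`, `atWorld_of_isRecordOfRecord₁₀CB10YZ`,
`isRecordOfRecord₁₀C_of_isRecordOfRecord₁₀CB10YZ`, `isRecordOfRecord₁₀CB10YZ_rebind_of_isRecordOfRecord₁₀C`), `Node00.Record10` (`IsRecordOfRecord₁₀C`), `Node00.CarriersW`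
(`IsRecordOfRecord₁₀CB10YZW`, `isRecordOfRecord₁₀CB10YZ_of_isRecordOfRecord₁₀CB10YZW`), NODE 00's ₅C
in-edge theorems (`b4∕b5∕b7_main_of_isRecordOfRecord₅C`, `N03_at_record₅C`), `Node00.CarriersZ` (`nonempty_residZ`), the N06 seat's located vacuity certificate
`N06AtRecord9CB10Y.exists_junkOps_b9LeafX_Y9OfRecord` (an operator layer exists), and this seat's ₉CB10 census twin (the supplier face `printedUV3V_of_uniformLeafSystems_at`
is RE-USED, not restated: the slot of record did not move).  NOT A DISCHARGE OF N08: every closer of §2 takes AS HYPOTHESIS the node's object gap — the slot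
of record `Node00.PrintedUV3V N L` («SOME version of print's transformations (2) carries [Balaban1985UV3] Thm 1 (compact reading) ∧ Thm 2 with their printed
∃-prefix, on SU(N), block size `L`»), TYPED, NOT ASSERTED — and the ∀-form over `IsRecordOfRecord₁₀CB10YZ` before an instance of that slot lands is
NOT-A-DISCHARGE (chair R447 guard; A1 = INHABITED-AT-₁₀C = W00's K0 at the current machine stage, neither proved nor assumed here: §4 proves only
«inhabited at ₁₀CB10YZ ⟺ inhabited at ₁₀C»).  `Record11` (the restate predicate, 11a–11d) will re-key these closers once more by the same one-line recipe
(dag-lead ₁₀-RE-KEY SCHEDULING, pub-ymgap INBOX l.11361).  Nothing of Bałaban's asserted; the d = 3 lattices of [B10] inside the d = 4 record, one finite torus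
per run at fixed spacing; nothing continuum ∕ ℝ³ ∕ ℝ⁴ ∕ infinite volume ∕ OS ∕ mass gap ∕ Clay.  0 `sorry`, 0 `def`, 0 `instance`, standard axioms.  Filed
`--supports` item `StabilityBAtRecord` (stmt-QuantumFields-19183) of route «BalabanUVNodes».

WHAT THIS FILE PROVES.
* §1 READING — `s_N08_iff₁₀CB10YZ_faces` (g30's `b10_main_iff_of_isRecordOfRecord₁₀CB10YZ` BY NAME); the in-edge guards `guards_of_isRecordOfRecord₁₀CB10YZ`
  (`b4 b5 b6 b7` HOLD at every run of every ₁₀CB10YZ record: N01 ∕ N02 ∕ N03 ∕ N04 at the ₅C shadow, def-T's `atWorld` transfer); the residual reading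
  `s_N08_iff₁₀CB10YZ` (⟺ «… `b8 → b9 → b11 → PrintedUV3V N L`»); and THE NEW FACE AT ₁₀ — `s_N08_iff₁₀CB10YZ_bundles`: `S_N08 (₁₀CB10YZ)` ⟺ «for every parameter
  package `(θ, Mstar, ops, ζ)` presenting a record, at every run: `b8 → B9LeafX (Y9OfRecord N θ₃ Mstar ops) → B11Leaf (Z11OfRecord F N ζ) → PrintedUV3V N θ.L`» —
  the in-edges `b9`, `b11` are now the PINNED [B9] ∕ [B11] bundle leaves of def-Y ∕ n07-a (g30's `leaves_b9_b10_b11_iff_of_isRecordOfRecord₁₀CB10YZ`), `b8` stays a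
  residual world leaf ([B8] group unpinned at ₁₀CB10YZ).
* §2 CLOSERS BY NAME — `s_N08_of_refines₁₀CB10YZ`, `s_N08_record₁₀CB10YZ_of_printedUV3V` (g30's `b10_main_of_isRecordOfRecord₁₀CB10YZ`), the per-record
  instances `…_at` (socket asked only at the block sizes the records present), and the instance at g30's FOUR-PIN cumulative predicate of record
  `IsRecordOfRecord₁₀CB10YZW` (`Node00/CarriersW.lean` p432637; `s_N08_record₁₀CB10YZW_of_printedUV3V`, by refinement `isRecordOfRecord₁₀CB10YZ_of_isRecordOfRecord₁₀CB10YZW`).  Binder whitelist: the world predicate + the ONE socket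
  `∀ L, Odd L → 1 < L → Node00.PrintedUV3V N L` (or its per-record instance); no `Consts`, no `Adm`, no leaf system, no chosen `𝔗`, no `tOfRecord₃`.
* §3 THE SUPPLIER FACE IS ₉CB10's — one theorem `s_N08_record₁₀CB10YZ_of_uniformLeafSystems_at` composing this seat's `printedUV3V_of_uniformLeafSystems_at 𝔗` (any
  version `𝔗` of print's transformations, every odd `L > 1`) with §2; the COUNT SENTENCE is unchanged: N08 becomes count-ready the day a lane END theorem inhabits
  `∃ c, c.Adm ∧ UniformLeafSystemsG N (runObjects₀T N 𝔗⋆ (Backgrounds.ofPrint N L)) c` for every odd `L > 1` at some `𝔗⋆`; the seat's located COUNT-PATH SEAM note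
  (`HOME/pub-ymgap-dag-n08-a/N08-COUNT-PATH-SEAM-E6.md`, 2026-08-26) records what the only typed END-theorem architecture consumes about print's averaging (15).
* §4 GUARDS — `inhabited₁₀CB10YZ_iff_inhabited₁₀C` (the cumulative pin adds no proviso: a ₁₀C record re-binds to a ₁₀CB10YZ record with the SAME datum for ANY
  floor, the junk operator layer of N06's certificate and any residual [B11] layer of `nonempty_residZ`), and `printedUV3V_of_s_N08_record₁₀CB10YZ` (under
  inhabitation the ∀-form closer reads the slot back at every presented, guarded block size — nothing weaker than the object gap is proved by §2).
-/

noncomputable section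

namespace Summit.QuantumFields.YangMills.BalabanUVNodes.N08AtRecord10CB10YZ

open Literature.MathematicalPhysics.QuantumFieldTheory.Balaban1983to89
open Literature.MathematicalPhysics.QuantumFieldTheory.Balaban1983to89.T4Continuum (T4Family FiniteEpsData)
open Literature.MathematicalPhysics.QuantumFieldTheory.Balaban1983to89.DagBinding (WorldP leavesP B9LeafX B11Leaf)
open Literature.MathematicalPhysics.QuantumFieldTheory.Balaban1983to89.Node00
open Literature.MathematicalPhysics.QuantumFieldTheory.Balaban1983to89.B10RunsOfRecord
  (Consts UniformLeafSystemsG runObjects₀T Backgrounds)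
open YMDAG.UVSplit (RecordPred Datum AtRecord S_N08)
open Summit.QuantumFields.YangMills.BalabanUVNodes.N08AtRecord9CB10 (printedUV3V_of_uniformLeafSystems_at)
open Summit.QuantumFields.YangMills.BalabanUVNodes.N06AtRecord9CB10Y (exists_junkOps_b9LeafX_Y9OfRecord)

variable {N : ℕ} [NeZero N]

/-! ## §1 READING — N08 at a ₁₀CB10YZ record by g30's faces; the in-edge guards; the residual reading; the new face through the pinned bundles -/

/-- **`S_N08` AT THE CUMULATIVE STAGE-10 PIN, READ BY g30's FACES** (`Node00.b10_main_iff_of_isRecordOfRecord₁₀CB10YZ` by name, no new face):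
`S_N08 (IsRecordOfRecord₁₀CB10YZ F N)` ⟺ «at every ₁₀CB10YZ record, at its block size `L` (`w.L = L`), at every run, the in-edge leaves imply the SLOT OF RECORD
`Node00.PrintedUV3V N L`». [cite: Balaban1985UV3, Thm 1 p.257 (compact reading) and Thm 2 p.272] -/
theorem s_N08_iff₁₀CB10YZ_faces :
    S_N08 (fun F D w => IsRecordOfRecord₁₀CB10YZ F N D w) ↔
      ∀ (F : T4Family) (D : Datum F N) (w : WorldP), IsRecordOfRecord₁₀CB10YZ F N D w → ∀ L : ℕ, w.L = (L : ℝ) →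
        ∀ P : B12.RunParams, (leavesP w P).b5 → (leavesP w P).b6 → (leavesP w P).b7 → (leavesP w P).b8 → (leavesP w P).b9 →
          (leavesP w P).b11 → PrintedUV3V N L := by
  refine ⟨fun hS F D w h L hL P => ?_, fun H F D w h P => ?_⟩
  · obtain ⟨L₀, -, hL₀, hiff⟩ := b10_main_iff_of_isRecordOfRecord₁₀CB10YZ h
    have hLL : L₀ = L := by exact_mod_cast hL₀.symm.trans hL
    subst hLL
    exact (hiff P).1 (hS F D w h P)
  · obtain ⟨L₀, -, hL₀, hiff⟩ := b10_main_iff_of_isRecordOfRecord₁₀CB10YZ h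
    exact (hiff P).2 (H F D w h L₀ hL₀ P)

section Guards

variable {F : T4Family} {D : Datum F N} {w : WorldP}

/-- **In-edge guards at every run of a ₁₀CB10YZ record**: the leaves `b4`, `b5`, `b6`, `b7` HOLD — N01, N02, N03, N04 are NODE 00 theorems at the Stage-5 shadow
(`Node00.b4∕b5∕b7_main_of_isRecordOfRecord₅C`, `Node00.N03_at_record₅C`), transferred to the cumulative Stage-10 record by g30's `Node00.atWorld_of_isRecordOfRecord₁₀CB10YZ`
(def-T's ₅C-at-the-shadow refinement; same world).  So no closer of this file is vacuous through `b5 b6 b7`.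
[cite: Balaban1983RegularityDecay, Theorem p.573; Balaban1984PropagatorsI, Props. 1.1–1.2 pp.33–36; Balaban1984PropagatorsII, Lemma 2.1 – Cor. 2.8 pp.234–249; Balaban1985Averaging, Props. 1–10 pp.26–50 (kernel versions at the objects of record; bookkeeping, transferred)] -/
theorem guards_of_isRecordOfRecord₁₀CB10YZ (h : IsRecordOfRecord₁₀CB10YZ F N D w) (P : B12.RunParams) :
    (leavesP w P).b4 ∧ (leavesP w P).b5 ∧ (leavesP w P).b6 ∧ (leavesP w P).b7 :=
  atWorld_of_isRecordOfRecord₁₀CB10YZ (X := fun ℓ => ℓ.b4 ∧ ℓ.b5 ∧ ℓ.b6 ∧ ℓ.b7)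
    (fun _ _ h5 Q =>
      have h4 := b4_main_of_isRecordOfRecord₅C h5 Q
      have h5' := b5_main_of_isRecordOfRecord₅C h5 Q h4
      ⟨h4, h5', N03_at_record₅C h5 Q h4 h5', b7_main_of_isRecordOfRecord₅C h5 Q h5'⟩)
    h P

/-- **N08 at a ₁₀CB10YZ record, the RESIDUAL READING**: with `L` the world's block size, at every run `Dag.B10_main ⟺ (b8 → b9 → b11 → PrintedUV3V N L)`
(the discharged in-edges `b5 b6 b7` drop out by the guards above). [cite: Balaban1985UV3, Thm 1 p.257 (compact reading) and Thm 2 p.272 (bookkeeping)] -/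
theorem b10_main_iff_residual_of_isRecordOfRecord₁₀CB10YZ (h : IsRecordOfRecord₁₀CB10YZ F N D w) :
    ∃ L : ℕ, (Odd L ∧ 1 < L) ∧ w.L = (L : ℝ) ∧ ∀ P : B12.RunParams,
      (Dag.B10_main (leavesP w P) ↔ ((leavesP w P).b8 → (leavesP w P).b9 → (leavesP w P).b11 → PrintedUV3V N L)) := by
  obtain ⟨L, hL, hwL, hiff⟩ := b10_main_iff_of_isRecordOfRecord₁₀CB10YZ h
  refine ⟨L, hL, hwL, fun P => ?_⟩
  obtain ⟨-, h5, h6, h7⟩ := guards_of_isRecordOfRecord₁₀CB10YZ h P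
  rw [hiff P]
  exact ⟨fun H h8 h9 h11 => H h5 h6 h7 h8 h9 h11, fun H _ _ _ h8 h9 h11 => H h8 h9 h11⟩

/-- **THE NEW FACE AT ₁₀ — N08 at a ₁₀CB10YZ record THROUGH THE PINNED BUNDLES**: for one parameter package `(θ, Mstar, ops, ζ)` presenting the record, at every run
`Dag.B10_main ⟺ (b8 → B9LeafX (Y9OfRecord N θ₃ Mstar ops) → B11Leaf (Z11OfRecord F N ζ) → PrintedUV3V N θ.L)` — the in-edges `b9` ([B9], N06) and `b11` ([B11], N07)
are the PINNED bundle leaves of g30's `leaves_b9_b10_b11_iff_of_isRecordOfRecord₁₀CB10YZ`; `b8` ([B8] group, unpinned at this record) stays a world leaf.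
[cite: Balaban1985UV3, Thm 1 p.257 + Thm 2 p.272; Balaban1985BackgroundPropagators, Thm 3.1 p.397; Balaban1985Variational, Thm 1 p.279 (the pinned in-edge objects; bookkeeping)] -/
theorem b10_main_iff_bundles_of_isRecordOfRecord₁₀CB10YZ (h : IsRecordOfRecord₁₀CB10YZ F N D w) :
    ∃ (θ : Stage9Params F N) (Mstar : ℕ) (ops : OpsY N θ.toStage3Params Mstar) (ζ : ResidZ F N), θ.Admissible ∧ w.L = (θ.L : ℝ) ∧
      ∀ P : B12.RunParams,
        (Dag.B10_main (leavesP w P) ↔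
          ((leavesP w P).b8 → B9LeafX (Y9OfRecord N θ.toStage3Params Mstar ops) → B11Leaf (Z11OfRecord F N ζ) → PrintedUV3V N θ.L)) := by
  obtain ⟨θ, Mstar, ops, ζ, hθ, hL, hl⟩ := leaves_b9_b10_b11_iff_of_isRecordOfRecord₁₀CB10YZ h
  refine ⟨θ, Mstar, ops, ζ, hθ, hL, fun P => ?_⟩
  obtain ⟨-, h5, h6, h7⟩ := guards_of_isRecordOfRecord₁₀CB10YZ h P
  unfold Dag.B10_main
  rw [(hl P).1, (hl P).2.1, (hl P).2.2]
  exact ⟨fun H h8 h9 h11 => H h5 h6 h7 h8 h9 h11, fun H _ _ _ h8 h9 h11 => H h8 h9 h11⟩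

end Guards

/-- **`S_N08` AT THE CUMULATIVE STAGE-10 PIN, RESIDUAL READING** (N08's census line at ₁₀CB10YZ): ⟺ «at every ₁₀CB10YZ record, at its block size `L`, at every run where
the in-edge leaves `b8 b9 b11` hold, the slot of record `Node00.PrintedUV3V N L`».  Neither side is claimed. [cite: Balaban1985UV3, Thm 1 p.257 (compact reading) and Thm 2 p.272] -/
theorem s_N08_iff₁₀CB10YZ :
    S_N08 (fun F D w => IsRecordOfRecord₁₀CB10YZ F N D w) ↔
      ∀ (F : T4Family) (D : Datum F N) (w : WorldP), IsRecordOfRecord₁₀CB10YZ F N D w → ∀ L : ℕ, w.L = (L : ℝ) →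
        ∀ P : B12.RunParams, (leavesP w P).b8 → (leavesP w P).b9 → (leavesP w P).b11 → PrintedUV3V N L := by
  refine ⟨fun hS F D w h L hL P h8 h9 h11 => ?_, fun H F D w h P => ?_⟩
  · obtain ⟨L₀, -, hL₀, hiff⟩ := b10_main_iff_residual_of_isRecordOfRecord₁₀CB10YZ h
    have hLL : L₀ = L := by exact_mod_cast hL₀.symm.trans hL
    subst hLL
    exact (hiff P).1 (hS F D w h P) h8 h9 h11
  · obtain ⟨L₀, -, hL₀, hiff⟩ := b10_main_iff_residual_of_isRecordOfRecord₁₀CB10YZ h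
    exact (hiff P).2 (H F D w h L₀ hL₀ P)

/-- **`S_N08` AT THE CUMULATIVE STAGE-10 PIN, THROUGH THE PINNED BUNDLES, EXACTLY** — the face that is NEW at ₁₀: `S_N08 (IsRecordOfRecord₁₀CB10YZ F N)` ⟺ «for every
parameter package `(θ, h, Mstar, ops, ζ)` of an admissible Stage-9 parameter with its Stage-10 provisos and every world bound over the cumulative view
`θ.view₁₀B10YZ Mstar ops ζ` (datum `datumOfRecord₁₀ F N θ h`, window `0 < γ ≤ θ.γ`, block size `θ.L`), at every run: `b8 → B9LeafX (Y9OfRecord N θ₃ Mstar ops) →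
B11Leaf (Z11OfRecord F N ζ) → PrintedUV3V N θ.L`».  The in-edges N06 ∕ N07 enter by their PINNED bundle leaves; neither they nor the slot are claimed.
[cite: Balaban1985UV3, Thm 1 p.257 + Thm 2 p.272; Balaban1985BackgroundPropagators, Thms 3.1–3.15 pp.397–432; Balaban1985Variational, Thm 1 p.279 (bookkeeping)] -/
theorem s_N08_iff₁₀CB10YZ_bundles :
    S_N08 (fun F D w => IsRecordOfRecord₁₀CB10YZ F N D w) ↔
      ∀ (F : T4Family) (θ : Stage9Params F N) (h : θ.Provisos₁₀) (Mstar : ℕ) (ops : OpsY N θ.toStage3Params Mstar) (ζ : ResidZ F N)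
        (w : WorldP), θ.Admissible → w.C = (datumOfRecord₁₀ F N θ h).C → (0 < w.γ ∧ w.γ ≤ θ.γ) → w.L = (θ.L : ℝ) →
        (∀ P, w.up P = upOfRecord₅C F N (θ.view₁₀B10YZ F N Mstar ops ζ) P) →
          ∀ P : B12.RunParams, (leavesP w P).b8 → B9LeafX (Y9OfRecord N θ.toStage3Params Mstar ops) →
            B11Leaf (Z11OfRecord F N ζ) → PrintedUV3V N θ.L := by
  refine ⟨fun hS F θ hP Mstar ops ζ w hθ hC hγ hL hup P h8 h9 h11 => ?_, fun H F D w h P => ?_⟩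
  · have hrec : IsRecordOfRecord₁₀CB10YZ F N (datumOfRecord₁₀ F N θ hP) w :=
      isRecordOfRecord₁₀CB10YZ_of_eq F N θ hP hθ Mstar ops ζ w hC hγ hL hup
    have hl := upOfRecord₅C_view₁₀B10YZ_leaves F N θ Mstar ops ζ P
    obtain ⟨-, h5, h6, h7⟩ := guards_of_isRecordOfRecord₁₀CB10YZ hrec P
    have h9' : (leavesP w P).b9 := by
      show (w.up P).b9
      rw [hup P]; exact hl.2.1.2 h9
    have h11' : (leavesP w P).b11 := by
      show (w.up P).b11
      rw [hup P]; exact hl.1.2 h11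
    have h10 : (leavesP w P).b10 := hS F _ w hrec P h5 h6 h7 h8 h9' h11'
    have h10' : (w.up P).b10 := h10
    rw [hup P] at h10'
    exact hl.2.2.1 h10'
  · obtain ⟨θ, hP, Mstar, ops, ζ, hθ, hD, hC, hγ, hL, hup⟩ := h
    subst hD
    have hl := upOfRecord₅C_view₁₀B10YZ_leaves F N θ Mstar ops ζ P
    intro _ _ _ h8 h9 h11
    have h9' : B9LeafX (Y9OfRecord N θ.toStage3Params Mstar ops) := by
      have : (w.up P).b9 := h9
      rw [hup P] at this; exact hl.2.1.1 this
    have h11' : B11Leaf (Z11OfRecord F N ζ) := by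
      have : (w.up P).b11 := h11
      rw [hup P] at this; exact hl.1.1 this
    show (w.up P).b10
    rw [hup P]
    exact hl.2.2.2 (H F θ hP Mstar ops ζ w hθ hC hγ hL hup P h8 h9' h11')

/-! ## §2 CLOSERS BY NAME — from the ONE declared socket `∀ L, Odd L → 1 < L → Node00.PrintedUV3V N L` (N08's object gap), nothing else -/

/-- **`S_N08 Rec` FOR EVERY RECORD PREDICATE REFINING THE CUMULATIVE STAGE-10 PIN, FROM THE SLOT OF RECORD** (g30's `Node00.b10_main_of_isRecordOfRecord₁₀CB10YZ` BY NAME;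
in-edges unused).  The hypothesis `hUV` IS N08's object gap; NOT-A-DISCHARGE until it is inhabited. [cite: Balaban1985UV3, Thm 1 p.257 (compact reading) and Thm 2 p.272] -/
theorem s_N08_of_refines₁₀CB10YZ (Rec : RecordPred N)
    (href : ∀ (F : T4Family) (D : Datum F N) (w : WorldP), Rec F D w → IsRecordOfRecord₁₀CB10YZ F N D w)
    (hUV : ∀ L : ℕ, Odd L → 1 < L → PrintedUV3V N L) : S_N08 Rec :=
  fun F D w hR P => b10_main_of_isRecordOfRecord₁₀CB10YZ hUV (href F D w hR) P

/-- **`S_N08` AT THE CUMULATIVE STAGE-10 PIN ITSELF, FROM THE SLOT OF RECORD** — the ∀-form closer of record for N08 at the current machine stage (NOT-A-DISCHARGE before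
an instance of the slot lands; chair R447 guard). [cite: Balaban1985UV3, Thm 1 p.257 (compact reading) and Thm 2 p.272] -/
theorem s_N08_record₁₀CB10YZ_of_printedUV3V (hUV : ∀ L : ℕ, Odd L → 1 < L → PrintedUV3V N L) :
    S_N08 (fun F D w => IsRecordOfRecord₁₀CB10YZ F N D w) :=
  s_N08_of_refines₁₀CB10YZ _ (fun _ _ _ h => h) hUV

/-- **Per-record instance of the socket**: `S_N08 Rec` for every `Rec` refining ₁₀CB10YZ from the slot of record asked ONLY at the block sizes the records of `Rec`
present (`w.L = L`). [cite: Balaban1985UV3, Thm 1 p.257 (compact reading) and Thm 2 p.272] -/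
theorem s_N08_of_refines₁₀CB10YZ_at (Rec : RecordPred N)
    (href : ∀ (F : T4Family) (D : Datum F N) (w : WorldP), Rec F D w → IsRecordOfRecord₁₀CB10YZ F N D w)
    (hUV : ∀ (F : T4Family) (D : Datum F N) (w : WorldP), Rec F D w → ∀ L : ℕ, w.L = (L : ℝ) → PrintedUV3V N L) :
    S_N08 Rec := by
  intro F D w hR P
  obtain ⟨L, -, hwL, hiff⟩ := b10_main_iff_of_isRecordOfRecord₁₀CB10YZ (href F D w hR)
  exact (hiff P).2 fun _ _ _ _ _ _ => hUV F D w hR L hwL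

/-- … and at ₁₀CB10YZ itself. [cite: Balaban1985UV3, Thm 1 p.257 (compact reading) and Thm 2 p.272] -/
theorem s_N08_record₁₀CB10YZ_of_printedUV3V_at
    (hUV : ∀ (F : T4Family) (D : Datum F N) (w : WorldP), IsRecordOfRecord₁₀CB10YZ F N D w → ∀ L : ℕ, w.L = (L : ℝ) → PrintedUV3V N L) :
    S_N08 (fun F D w => IsRecordOfRecord₁₀CB10YZ F N D w) :=
  s_N08_of_refines₁₀CB10YZ_at _ (fun _ _ _ h => h) hUV

/-- **The four-pin instance**: `S_N08` at node00-def g30's cumulative predicate of record `Node00.IsRecordOfRecord₁₀CB10YZW` ([B15] group `W` pinned on top of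
[B10] ∕ [B9] ∕ [B11]; `Node00.isRecordOfRecord₁₀CB10YZ_of_isRecordOfRecord₁₀CB10YZW` BY NAME, same datum and world), from the same socket — the [B10] face survives
every later carrier pin by refinement. [cite: Balaban1985UV3, Thm 1 p.257 (compact reading) and Thm 2 p.272] -/
theorem s_N08_record₁₀CB10YZW_of_printedUV3V (hUV : ∀ L : ℕ, Odd L → 1 < L → PrintedUV3V N L) :
    S_N08 (fun F D w => IsRecordOfRecord₁₀CB10YZW F N D w) :=
  s_N08_of_refines₁₀CB10YZ _ (fun _ _ _ h => isRecordOfRecord₁₀CB10YZ_of_isRecordOfRecord₁₀CB10YZW h) hUV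

/-! ## §3 THE SUPPLIER FACE IS ₉CB10's (`N08AtRecord9CB10.printedUV3V_of_uniformLeafSystems_at`, re-used) -/

/-- **N08 at the cumulative Stage-10 pin FROM UNIFORM LEAF SYSTEMS ON PRINT'S RUNS at any version `𝔗 L` of print's transformations, every odd `L > 1`** — the
composition of this seat's supplier face `printedUV3V_of_uniformLeafSystems_at` (∃-introduction into the slot; antecedent EXACTLY that of
`B10RunsOfRecord.printedUV3G_of_uniformLeafSystems` at `runObjects₀T N (𝔗 L) (Backgrounds.ofPrint N L)`) with §2.  The hypothesis is the d = 3 lane's END-theorem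
shape transported to print's binders — N08's count line the day it is inhabited; what that architecture consumes about print's averaging (15) is the seat's located
COUNT-PATH SEAM note (header §3). [cite: Balaban1985UV3, Thm 1 p.257, Thm 2 p.272, Sect. D pp.272–275; Balaban1985Averaging, (10) + (15) p.19] -/
theorem s_N08_record₁₀CB10YZ_of_uniformLeafSystems_at (𝔗 : ∀ L : ℕ, TFamily₃ N L)
    (h : ∀ L : ℕ, Odd L → 1 < L →
      ∃ c : Consts L, c.Adm ∧ UniformLeafSystemsG N (runObjects₀T N (𝔗 L) (Backgrounds.ofPrint N L)) c) :
    S_N08 (fun F D w => IsRecordOfRecord₁₀CB10YZ F N D w) :=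
  s_N08_record₁₀CB10YZ_of_printedUV3V fun L hO hL => printedUV3V_of_uniformLeafSystems_at (𝔗 L) (h L hO hL)

/-! ## §4 GUARDS — inhabitation of the cumulative pinned class is Stage 10's exactly (W00's K0, not claimed here) -/

/-- **INHABITED-AT-₁₀CB10YZ ⟺ INHABITED-AT-₁₀C, family by family**: refinement `Node00.isRecordOfRecord₁₀C_of_isRecordOfRecord₁₀CB10YZ` one way; the other way a ₁₀C
record RE-BINDS to a ₁₀CB10YZ record with the SAME datum (`Node00.isRecordOfRecord₁₀CB10YZ_rebind_of_isRecordOfRecord₁₀C`) for ANY floor (here `0`), the junk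
operator layer of the N06 seat's located certificate (`exists_junkOps_b9LeafX_Y9OfRecord`: an `OpsY` exists at every admissible dictionary) and any residual [B11]
layer (`Node00.nonempty_residZ`).  The pin adds no proviso and no admissibility clause; the A1 guard of any future N08 count line at this stage is W00's
INHABITED-AT-₁₀C, neither proved nor assumed in this file. [cite: Balaban1989LargeFieldII, Thm 1 + (0.1) pp.355–356 (objects of record; bookkeeping)] -/
theorem inhabited₁₀CB10YZ_iff_inhabited₁₀C (F : T4Family) :
    (∃ (D : Datum F N) (w : WorldP), IsRecordOfRecord₁₀CB10YZ F N D w) ↔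
      ∃ (D : Datum F N) (w : WorldP), IsRecordOfRecord₁₀C F N D w := by
  refine ⟨fun ⟨D, w, h⟩ => ⟨D, w, isRecordOfRecord₁₀C_of_isRecordOfRecord₁₀CB10YZ h⟩, fun ⟨D, w, h⟩ => ?_⟩
  obtain ⟨θ, _, hθ, -, h10⟩ := isRecordOfRecord₁₀CB10YZ_rebind_of_isRecordOfRecord₁₀C h
  obtain ⟨ops, -, -⟩ := exists_junkOps_b9LeafX_Y9OfRecord (N := N) θ.toStage3Params hθ.1.1.1.1 0
  obtain ⟨ζ⟩ := nonempty_residZ F N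
  exact ⟨D, _, h10 0 ops ζ⟩

/-- **Under inhabitation the ∀-form closer is NOT vacuous and reads the slot back**: if `S_N08` holds at the cumulative Stage-10 pin and some ₁₀CB10YZ record on some
family has block size `L` and a run at which the in-edges `b8 b9 b11` hold, then `Node00.PrintedUV3V N L` HOLDS — §2 proves nothing weaker than the object gap at
every presented, guarded block size. [cite: Balaban1985UV3, Thm 1 p.257 (compact reading) and Thm 2 p.272 (bookkeeping)] -/
theorem printedUV3V_of_s_N08_record₁₀CB10YZ (hS : S_N08 (fun F D w => IsRecordOfRecord₁₀CB10YZ F N D w))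
    {F : T4Family} {D : Datum F N} {w : WorldP} (h : IsRecordOfRecord₁₀CB10YZ F N D w) {L : ℕ} (hL : w.L = (L : ℝ))
    {P : B12.RunParams} (h8 : (leavesP w P).b8) (h9 : (leavesP w P).b9) (h11 : (leavesP w P).b11) : PrintedUV3V N L :=
  s_N08_iff₁₀CB10YZ.1 hS F D w h L hL P h8 h9 h11

end Summit.QuantumFields.YangMills.BalabanUVNodes.N08AtRecord10CB10YZ

end
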